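import Literature.AlgebraicGeometry.Resolution.LogBlowupChart
import HarnessLib

/-!
# Crux `FrobeniusLadder.FRationalResolution` (stmt-ResolutionOfSingularities-15317), line `redirect`,
# stub `stub_diagonalizableQuotientResolution` — **the vertex chart monoid of a rank-two log blow-up:
# coordinates, face hypotheses, irreducibles, and the recursion `c ↦ c − 2`** (point-blow-up recursion
# for the surface case over arbitrary fields, memo MEMO-15317-leafhand2-g6 §4, brick P4 — the part
# that does NOT need the Hilbert-basis chain of the initial cone)

Pure monoid combinatorics in `ℤⁿ` modulo a subgroup `L` (the unit-face group `ℤF_𝔭` of the ring-level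
files `…ChartAlgebra*`). A **vertex chart monoid with parameter `c`** is a submonoid `Q ⊆ ℤⁿ` of the form

  `Q = L + {m·v + l·x : m ≥ 0, m + c·l ≥ 0}`,  `(v, x)` independent modulo `L`,

i.e. `Q = L ⊕ ⟨v, x, y⟩` with the single relation `x + y = c·v` (`y = c·v − x`): for `c = b − 2` this is
the chart monoid `P_{v}` of the blow-up of the closed point at an interior Hilbert-basis element `v` with
neighbours `v + x`, `v + y` and coefficient `b` (`(v+x) + (v+y) = b·v`) of a two-dimensional saturated
sharp cone — the `A_{c−1}`-type monoid `⟨(1,0),(0,1),(c,−1)⟩`. We take the displayed description as the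
HYPOTHESIS (`hQ`) and prove what the ring-level theorems consume:

* `vertex_face` — hypothesis (S)/(H) of `…ChartAlgebraNormalForm`: `q₁ + q₂ ∈ L ⇒ q₁ ∈ L` (`c ≥ 1`);
* `vertex_saturated` — `Q` is saturated in `ℤⁿ` when `L + ℤv + ℤx = ℤⁿ`;
* `vertex_irr₁`, `vertex_irr₂` — for `c ≥ 2` the three monomials `v, x, y` are pairwise incomparable and
  not sums of two non-units modulo `L` (hypotheses `hirr₁`, `hirr₂` of `…ChartAlgebraFixedPointEmbdim`:
  the fixed point of the chart has embedding dimension `≥ 3`);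
* **`mem_vertexBlowup_iff`** — THE RECURSION: for `c ≥ 2` the chart monoid of the NEXT point blow-up at
  `v`, `Q⁽¹⁾ = ⟨Q ∪ ((Q ∖ L) − v)⟩`, is again a vertex chart monoid, with data `(v, x − v)` and parameter
  `c − 2`; `mem_endBlowup_iff` — the other two charts `⟨Q ∪ ((Q ∖ L) − x)⟩`, `⟨Q ∪ ((Q ∖ L) − y)⟩` are
  `L ⊕ ℕ²` on the bases `(x, v − x)`, `(y, v − y)` (free: regular charts).

So along the fixed points the parameter drops by `2` per blow-up and the recursion stops at `c ≤ 1`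
(`c = 0`: `L ⊕ ℕv ⊕ ℤx`; `c = 1`: `L ⊕ ℕx ⊕ ℕy`, both orthant-like). Honest label: combinatorics toward ONE
leaf stub (no stub, crux or summit closed). No definitions, no named facts, no sorry.
[cite: Kato1994, (10.1)] [cite: KempfEtAl1973, Ch. I §2]
-/

-- single-problem summit: the doubled namespace component is forced
set_option linter.dupNamespace false

namespace Summit.ResolutionOfSingularities.ResolutionOfSingularities.Theorems.FRationalResolution.VertexChartMonoid

variable {n : ℕ} {L : Submodule ℤ (Fin n → ℤ)} {Q : AddSubmonoid (Fin n → ℤ)} {v x : Fin n → ℤ} {c : ℕ}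

/-! ### Coordinates -/

/-- From `m ≥ 0`, `m + c l ≥ 0`: either `l ≥ 0`, or `l ≤ −1` and `m ≥ c`. [folklore] -/
theorem coord_cases {m l : ℤ} (hm : 0 ≤ m) (hml : 0 ≤ m + (c : ℤ) * l) :
    (0 ≤ l ∧ 0 ≤ m) ∨ (l ≤ -1 ∧ (c : ℤ) ≤ m) := by
  rcases le_or_gt 0 l with hl | hl
  · exact Or.inl ⟨hl, hm⟩
  · right
    refine ⟨by omega, ?_⟩
    have : (c : ℤ) * l ≤ (c : ℤ) * (-1) := by
      apply mul_le_mul_of_nonneg_left _ (by positivity); omega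
    linarith

/-- Linear consequences of `0 ≤ c`, `k ≤ c` for the products `c·l`, `k·l` (for `omega`). [folklore] -/
theorem mul_le_facts (c : ℕ) (l : ℤ) :
    (0 ≤ l → 0 ≤ (c : ℤ) * l) ∧ (l ≤ 0 → (c : ℤ) * l ≤ 0) ∧
      ∀ k : ℕ, k ≤ c → (0 ≤ l → (k : ℤ) * l ≤ (c : ℤ) * l) ∧ (l ≤ 0 → (c : ℤ) * l ≤ (k : ℤ) * l) := by
  refine ⟨fun hl => by positivity, fun hl => mul_nonpos_of_nonneg_of_nonpos (by positivity) hl,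
    fun k hk => ⟨fun hl => ?_, fun hl => ?_⟩⟩
  · exact mul_le_mul_of_nonneg_right (by exact_mod_cast hk) hl
  · exact mul_le_mul_of_nonpos_right (by exact_mod_cast hk) hl

/-- More linear consequences: `j ≤ l ⇒ jc ≤ cl` and `l ≤ −j ⇒ cl ≤ −jc` (for `omega`). [folklore] -/
theorem mul_le_facts' (c : ℕ) (l : ℤ) (j : ℕ) :
    ((j : ℤ) ≤ l → (j : ℤ) * (c : ℤ) ≤ (c : ℤ) * l) ∧ (l ≤ -(j : ℤ) → (c : ℤ) * l ≤ -((j : ℤ) * (c : ℤ))) := by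
  refine ⟨fun hl => ?_, fun hl => ?_⟩
  · rw [mul_comm (j : ℤ)]
    exact mul_le_mul_of_nonneg_left hl (by positivity)
  · have := mul_le_mul_of_nonneg_left hl (show (0 : ℤ) ≤ c by positivity)
    linarith

/-- Uniqueness of coordinates modulo `L`. [folklore] -/
theorem coord_unique (hind : ∀ g ∈ L, ∀ m l : ℤ, g + m • v + l • x = 0 → m = 0 ∧ l = 0)
    {g g' : Fin n → ℤ} (hg : g ∈ L) (hg' : g' ∈ L) {m l m' l' : ℤ}
    (h : g + m • v + l • x = g' + m' • v + l' • x) : m = m' ∧ l = l' := by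
  have h1 : (g - g') + (m - m') • v + (l - l') • x = 0 := by
    rw [sub_smul, sub_smul]
    have := sub_eq_zero.2 h
    calc (g - g') + (m • v - m' • v) + (l • x - l' • x)
        = (g + m • v + l • x) - (g' + m' • v + l' • x) := by abel
      _ = 0 := this
  have h2 := hind _ (L.sub_mem hg hg') _ _ h1
  omega

/-- An element written in coordinates lies in `L` iff both coordinates vanish. [folklore] -/
theorem mem_L_iff (hind : ∀ g ∈ L, ∀ m l : ℤ, g + m • v + l • x = 0 → m = 0 ∧ l = 0)
    {g : Fin n → ℤ} (hg : g ∈ L) {m l : ℤ} : g + m • v + l • x ∈ L ↔ m = 0 ∧ l = 0 := by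
  constructor
  · intro h
    have h1 : (g - (g + m • v + l • x)) + m • v + l • x = 0 := by abel
    exact hind _ (L.sub_mem hg h) _ _ h1
  · rintro ⟨rfl, rfl⟩
    simpa using hg

/-! ### The face hypothesis (S) -/

/-- **(S) for the vertex chart**: with `c ≥ 1`, if `q₁, q₂ ∈ Q` and `q₁ + q₂ ∈ L` then `q₁ ∈ L` (the
cone `{m ≥ 0, m + cl ≥ 0}` is strongly convex). [cite: Kato1994, (10.1)] -/
theorem vertex_face (hc : 1 ≤ c)
    (hQ : ∀ w, w ∈ Q ↔ ∃ g ∈ L, ∃ m l : ℤ, 0 ≤ m ∧ 0 ≤ m + (c : ℤ) * l ∧ w = g + m • v + l • x)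
    (hind : ∀ g ∈ L, ∀ m l : ℤ, g + m • v + l • x = 0 → m = 0 ∧ l = 0) :
    ∀ q₁ ∈ Q, ∀ q₂ ∈ Q, q₁ + q₂ ∈ L → q₁ ∈ L := by
  intro q₁ hq₁ q₂ hq₂ h12
  obtain ⟨g₁, hg₁, m₁, l₁, hm₁, hml₁, rfl⟩ := (hQ q₁).1 hq₁
  obtain ⟨g₂, hg₂, m₂, l₂, hm₂, hml₂, rfl⟩ := (hQ q₂).1 hq₂
  have hsum : g₁ + m₁ • v + l₁ • x + (g₂ + m₂ • v + l₂ • x) =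
      (g₁ + g₂) + (m₁ + m₂) • v + (l₁ + l₂) • x := by
    rw [add_smul, add_smul]; abel
  rw [hsum, mem_L_iff hind (L.add_mem hg₁ hg₂)] at h12
  rw [mem_L_iff hind hg₁]
  rcases coord_cases hm₁ hml₁ with ⟨h1, -⟩ | ⟨h1, h1'⟩ <;>
    rcases coord_cases hm₂ hml₂ with ⟨h2, -⟩ | ⟨h2, h2'⟩ <;> omega

/-! ### Saturation -/

/-- **The vertex chart monoid is saturated** in `ℤⁿ` (given that `L + ℤv + ℤx = ℤⁿ`).
[cite: Kato1994, (10.1)] -/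
theorem vertex_saturated
    (hQ : ∀ w, w ∈ Q ↔ ∃ g ∈ L, ∃ m l : ℤ, 0 ≤ m ∧ 0 ≤ m + (c : ℤ) * l ∧ w = g + m • v + l • x)
    (hind : ∀ g ∈ L, ∀ m l : ℤ, g + m • v + l • x = 0 → m = 0 ∧ l = 0)
    (hspan : ∀ w : Fin n → ℤ, ∃ g ∈ L, ∃ m l : ℤ, w = g + m • v + l • x) :
    ∀ (w : Fin n → ℤ) (k : ℕ), 0 < k → k • w ∈ Q → w ∈ Q := by
  intro w k hk hkw
  obtain ⟨g, hg, m, l, rfl⟩ := hspan w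
  obtain ⟨g', hg', m', l', hm', hml', hEq⟩ := (hQ _).1 hkw
  have h1 : k • (g + m • v + l • x) = k • g + ((k : ℤ) * m) • v + ((k : ℤ) * l) • x := by
    rw [smul_add, smul_add, mul_smul, mul_smul, ← natCast_zsmul g, ← natCast_zsmul (m • v),
      ← natCast_zsmul (l • x)]
  rw [h1] at hEq
  obtain ⟨hm, hl⟩ := coord_unique hind (L.smul_mem _ hg) hg' hEq
  refine (hQ _).2 ⟨g, hg, m, l, ?_, ?_, rfl⟩
  · have : 0 ≤ (k : ℤ) * m := by rw [hm]; exact hm'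
    exact nonneg_of_mul_nonneg_right this (by exact_mod_cast hk)
  · have h2 : 0 ≤ (k : ℤ) * (m + (c : ℤ) * l) := by
      have : (k : ℤ) * (m + (c : ℤ) * l) = m' + (c : ℤ) * l' := by rw [← hm, ← hl]; ring
      rw [this]; exact hml'
    exact nonneg_of_mul_nonneg_right h2 (by exact_mod_cast hk)

/-! ### The three irreducible monomials `v`, `x`, `y = c·v − x` -/

/-- `v`, `x`, `y = c v − x` lie in `Q` and not in `L`. [cite: Kato1994, (10.1)] -/
theorem vertex_gens_mem
    (hQ : ∀ w, w ∈ Q ↔ ∃ g ∈ L, ∃ m l : ℤ, 0 ≤ m ∧ 0 ≤ m + (c : ℤ) * l ∧ w = g + m • v + l • x)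
    (hind : ∀ g ∈ L, ∀ m l : ℤ, g + m • v + l • x = 0 → m = 0 ∧ l = 0) :
    (v ∈ Q ∧ v ∉ L) ∧ (x ∈ Q ∧ x ∉ L) ∧ ((c : ℤ) • v - x ∈ Q ∧ (c : ℤ) • v - x ∉ L) := by
  have e1 : v = 0 + (1 : ℤ) • v + (0 : ℤ) • x := by simp
  have e2 : x = 0 + (0 : ℤ) • v + (1 : ℤ) • x := by simp
  have e3 : (c : ℤ) • v - x = 0 + (c : ℤ) • v + (-1 : ℤ) • x := by simp [sub_eq_add_neg]
  refine ⟨⟨(hQ _).2 ⟨0, L.zero_mem, 1, 0, by norm_num, by norm_num, e1⟩, fun h => ?_⟩,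
    ⟨(hQ _).2 ⟨0, L.zero_mem, 0, 1, le_rfl, by positivity, e2⟩, fun h => ?_⟩,
    ⟨(hQ _).2 ⟨0, L.zero_mem, c, -1, by positivity, by simp, e3⟩, fun h => ?_⟩⟩
  · rw [e1, mem_L_iff hind L.zero_mem] at h; omega
  · rw [e2, mem_L_iff hind L.zero_mem] at h; omega
  · rw [e3, mem_L_iff hind L.zero_mem] at h; omega

/-- **`hirr₁` for `{v, x, y}`**, `c ≥ 2`: no difference of two of the three monomials lies in `Q + L`.
Stated for an arbitrary pair of coordinate vectors among `(1,0), (0,1), (c,−1)`. [cite: Kato1994, (10.1)] -/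
theorem vertex_irr₁ (hc : 2 ≤ c)
    (hQ : ∀ w, w ∈ Q ↔ ∃ g ∈ L, ∃ m l : ℤ, 0 ≤ m ∧ 0 ≤ m + (c : ℤ) * l ∧ w = g + m • v + l • x)
    (hind : ∀ g ∈ L, ∀ m l : ℤ, g + m • v + l • x = 0 → m = 0 ∧ l = 0)
    {m₁ l₁ m₂ l₂ : ℤ}
    (h₁ : (m₁ = 1 ∧ l₁ = 0) ∨ (m₁ = 0 ∧ l₁ = 1) ∨ (m₁ = c ∧ l₁ = -1))
    (h₂ : (m₂ = 1 ∧ l₂ = 0) ∨ (m₂ = 0 ∧ l₂ = 1) ∨ (m₂ = c ∧ l₂ = -1))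
    (hne : (m₁, l₁) ≠ (m₂, l₂)) (s : Fin n → ℤ) (hs : s ∈ Q) :
    (m₁ • v + l₁ • x) - (m₂ • v + l₂ • x) - s ∉ L := by
  obtain ⟨g, hg, m, l, hm, hml, rfl⟩ := (hQ s).1 hs
  have e : (m₁ • v + l₁ • x) - (m₂ • v + l₂ • x) - (g + m • v + l • x) =
      (-g) + (m₁ - m₂ - m) • v + (l₁ - l₂ - l) • x := by
    rw [sub_smul, sub_smul, sub_smul, sub_smul]; abel
  rw [e, mem_L_iff hind (L.neg_mem hg)]
  intro h
  have hpair : ¬ (m₁ = m₂ ∧ l₁ = l₂) := fun h' => hne (by rw [h'.1, h'.2])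
  obtain ⟨f1, f2, f3⟩ := mul_le_facts c l
  have f4 := f3 2 hc
  have f5 := mul_le_facts' c l 1
  have f6 := mul_le_facts' c l 2
  omega

/-- **`hirr₂` for `{v, x, y}`**, `c ≥ 2`: none of the three monomials is a sum of two elements of
`Q ∖ L` plus an element of `Q`, modulo `L`. [cite: Kato1994, (10.1)] -/
theorem vertex_irr₂ (hc : 2 ≤ c)
    (hQ : ∀ w, w ∈ Q ↔ ∃ g ∈ L, ∃ m l : ℤ, 0 ≤ m ∧ 0 ≤ m + (c : ℤ) * l ∧ w = g + m • v + l • x)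
    (hind : ∀ g ∈ L, ∀ m l : ℤ, g + m • v + l • x = 0 → m = 0 ∧ l = 0)
    {m₀ l₀ : ℤ} (h₀ : (m₀ = 1 ∧ l₀ = 0) ∨ (m₀ = 0 ∧ l₀ = 1) ∨ (m₀ = c ∧ l₀ = -1))
    (q₁ : Fin n → ℤ) (hq₁ : q₁ ∈ Q) (q₂ : Fin n → ℤ) (hq₂ : q₂ ∈ Q) (hq₁L : q₁ ∉ L) (hq₂L : q₂ ∉ L)
    (s : Fin n → ℤ) (hs : s ∈ Q) :
    (m₀ • v + l₀ • x) - (q₁ + q₂) - s ∉ L := by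
  obtain ⟨g₁, hg₁, m₁, l₁, hm₁, hml₁, rfl⟩ := (hQ q₁).1 hq₁
  obtain ⟨g₂, hg₂, m₂, l₂, hm₂, hml₂, rfl⟩ := (hQ q₂).1 hq₂
  obtain ⟨g, hg, m, l, hm, hml, rfl⟩ := (hQ s).1 hs
  rw [mem_L_iff hind hg₁] at hq₁L
  rw [mem_L_iff hind hg₂] at hq₂L
  have e : (m₀ • v + l₀ • x) - (g₁ + m₁ • v + l₁ • x + (g₂ + m₂ • v + l₂ • x)) - (g + m • v + l • x) =
      (-(g₁ + g₂ + g)) + (m₀ - m₁ - m₂ - m) • v + (l₀ - l₁ - l₂ - l) • x := by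
    rw [sub_smul, sub_smul, sub_smul, sub_smul, sub_smul, sub_smul]; abel
  rw [e, mem_L_iff hind (L.neg_mem (L.add_mem (L.add_mem hg₁ hg₂) hg))]
  intro h
  have a1 := (mul_le_facts c l₁).1
  have a5 := (mul_le_facts' c l₁ 1).2
  have a6 := (mul_le_facts' c l₁ 2).2
  have b1 := (mul_le_facts c l₂).1
  have b5 := (mul_le_facts' c l₂ 1).2
  have b6 := (mul_le_facts' c l₂ 2).2
  have d1 := (mul_le_facts c l).1
  have d5 := (mul_le_facts' c l 1).2
  have d6 := (mul_le_facts' c l 2).2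
  push_cast at a5 a6 b5 b6 d5 d6
  rcases h₀ with ⟨rfl, rfl⟩ | ⟨rfl, rfl⟩ | ⟨rfl, rfl⟩ <;> omega

/-! ### The recursion: the next blow-up charts -/

/-- **The vertex chart of the next blow-up is a vertex chart with parameter `c − 2`.** For `c ≥ 2`,
the chart monoid `⟨Q ∪ ((Q ∖ L) − v)⟩` of the blow-up of the fixed point at `v` is
`L + {m·v + l·(x − v) : m ≥ 0, m + (c − 2)·l ≥ 0}` (and `(v, x − v)` is again independent modulo `L`).
[cite: Kato1994, (10.1)] -/
theorem mem_vertexBlowup_iff (hc : 2 ≤ c)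
    (hQ : ∀ w, w ∈ Q ↔ ∃ g ∈ L, ∃ m l : ℤ, 0 ≤ m ∧ 0 ≤ m + (c : ℤ) * l ∧ w = g + m • v + l • x)
    (hind : ∀ g ∈ L, ∀ m l : ℤ, g + m • v + l • x = 0 → m = 0 ∧ l = 0) (w : Fin n → ℤ) :
    w ∈ AddSubmonoid.closure ((Q : Set (Fin n → ℤ)) ∪ (fun q => q - v) '' {q | q ∈ Q ∧ q ∉ L}) ↔
      ∃ g ∈ L, ∃ m l : ℤ, 0 ≤ m ∧ 0 ≤ m + ((c - 2 : ℕ) : ℤ) * l ∧ w = g + m • v + l • (x - v) := by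
  have hc2 : ((c - 2 : ℕ) : ℤ) = (c : ℤ) - 2 := by omega
  constructor
  · intro hw
    induction hw using AddSubmonoid.closure_induction with
    | mem z hz =>
      rcases hz with hz | ⟨q, ⟨hq, hqL⟩, rfl⟩
      · obtain ⟨g, hg, m, l, hm, hml, rfl⟩ := (hQ z).1 hz
        obtain ⟨f1, f2, f3⟩ := mul_le_facts c l
        have f4 := f3 2 hc
        refine ⟨g, hg, m + l, l, by omega, ?_, by module⟩
        rw [hc2, sub_mul]; omega
      · obtain ⟨g, hg, m, l, hm, hml, rfl⟩ := (hQ q).1 hq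
        rw [mem_L_iff hind hg] at hqL
        obtain ⟨f1, f2, f3⟩ := mul_le_facts c l
        have f4 := f3 2 hc
        have f5 := f3 1 (by omega)
        refine ⟨g, hg, m + l - 1, l, by omega, ?_, by module⟩
        rw [hc2, sub_mul]; omega
    | zero => exact ⟨0, L.zero_mem, 0, 0, le_rfl, by simp, by simp⟩
    | add y z _ _ hy hz =>
      obtain ⟨g₁, hg₁, m₁, l₁, hm₁, hml₁, rfl⟩ := hy
      obtain ⟨g₂, hg₂, m₂, l₂, hm₂, hml₂, rfl⟩ := hz
      refine ⟨g₁ + g₂, L.add_mem hg₁ hg₂, m₁ + m₂, l₁ + l₂, by omega, ?_, by module⟩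
      rw [mul_add]; omega
  · rintro ⟨g, hg, m, l, hm, hml, rfl⟩
    rw [hc2] at hml
    obtain ⟨⟨hvQ, hvL⟩, ⟨hxQ, hxL⟩, ⟨hyQ, hyL⟩⟩ := vertex_gens_mem hQ hind
    have hgQ : g ∈ Q := (hQ g).2 ⟨g, hg, 0, 0, le_rfl, by simp, by simp⟩
    -- generators of the closure
    have hQ' : ∀ q ∈ Q, q ∈ AddSubmonoid.closure ((Q : Set (Fin n → ℤ)) ∪
        (fun q => q - v) '' {q | q ∈ Q ∧ q ∉ L}) := fun q hq => AddSubmonoid.subset_closure (Or.inl hq)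
    have hgen : ∀ q ∈ Q, q ∉ L → q - v ∈ AddSubmonoid.closure ((Q : Set (Fin n → ℤ)) ∪
        (fun q => q - v) '' {q | q ∈ Q ∧ q ∉ L}) :=
      fun q hq hqL => AddSubmonoid.subset_closure (Or.inr ⟨q, ⟨hq, hqL⟩, rfl⟩)
    -- `v = 2v − v`, `x − v`, `y − v` are generators
    have h2v : (2 : ℤ) • v ∈ Q ∧ (2 : ℤ) • v ∉ L := by
      have e : (2 : ℤ) • v = 0 + (2 : ℤ) • v + (0 : ℤ) • x := by simp
      refine ⟨(hQ _).2 ⟨0, L.zero_mem, 2, 0, by norm_num, by norm_num, e⟩, fun h => ?_⟩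
      rw [e, mem_L_iff hind L.zero_mem] at h; omega
    have hv' : v ∈ AddSubmonoid.closure ((Q : Set (Fin n → ℤ)) ∪ (fun q => q - v) '' {q | q ∈ Q ∧ q ∉ L}) := by
      have := hgen _ h2v.1 h2v.2
      rwa [two_smul, add_sub_cancel_right] at this
    have hx' := hgen _ hxQ hxL
    have hy' := hgen _ hyQ hyL
    set M := AddSubmonoid.closure ((Q : Set (Fin n → ℤ)) ∪ (fun q => q - v) '' {q | q ∈ Q ∧ q ∉ L})
    rcases le_or_gt 0 l with hl | hl
    · -- `g + m v + l (x − v)`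
      have e : g + m • v + l • (x - v) = g + m.toNat • v + l.toNat • (x - v) := by
        rw [← natCast_zsmul v, ← natCast_zsmul (x - v), Int.toNat_of_nonneg hm, Int.toNat_of_nonneg hl]
      rw [e]
      exact M.add_mem (M.add_mem (hQ' g hgQ) (M.nsmul_mem hv' _)) (M.nsmul_mem hx' _)
    · -- `l < 0`: `m v + l (x − v) = |l| (y − v) + (m + (c−2) l) v`
      have hm' : 0 ≤ m + ((c : ℤ) - 2) * l := hml
      have e : g + m • v + l • (x - v) =
          g + (m + ((c : ℤ) - 2) * l).toNat • v + (-l).toNat • ((c : ℤ) • v - x - v) := by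
        rw [← natCast_zsmul v, ← natCast_zsmul ((c : ℤ) • v - x - v), Int.toNat_of_nonneg hm',
          Int.toNat_of_nonneg (by omega : 0 ≤ -l)]
        module
      rw [e]
      exact M.add_mem (M.add_mem (hQ' g hgQ) (M.nsmul_mem hv' _)) (M.nsmul_mem hy' _)

/-- Independence modulo `L` is inherited by the new data `(v, x − v)`. [folklore] -/
theorem vertexBlowup_independent
    (hind : ∀ g ∈ L, ∀ m l : ℤ, g + m • v + l • x = 0 → m = 0 ∧ l = 0) :
    ∀ g ∈ L, ∀ m l : ℤ, g + m • v + l • (x - v) = 0 → m = 0 ∧ l = 0 := by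
  intro g hg m l h
  have h1 : g + (m - l) • v + l • x = 0 := by
    rw [← h, sub_smul, smul_sub]; abel
  have := hind g hg _ _ h1
  omega

/-- **The end charts of the next blow-up are free modulo `L`.** For `c ≥ 2`, the chart monoid
`⟨Q ∪ ((Q ∖ L) − x)⟩` at the monomial `x` is `L + ℕx + ℕ(v − x)`. (The chart at `y` is symmetric
under `x ↔ y`, which preserves the hypothesis with the same `c`: `Q = L + {m v + l y}` in the data
`(v, y)`.) [cite: Kato1994, (10.1)] -/
theorem mem_endBlowup_iff (hc : 2 ≤ c)
    (hQ : ∀ w, w ∈ Q ↔ ∃ g ∈ L, ∃ m l : ℤ, 0 ≤ m ∧ 0 ≤ m + (c : ℤ) * l ∧ w = g + m • v + l • x)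
    (hind : ∀ g ∈ L, ∀ m l : ℤ, g + m • v + l • x = 0 → m = 0 ∧ l = 0) (w : Fin n → ℤ) :
    w ∈ AddSubmonoid.closure ((Q : Set (Fin n → ℤ)) ∪ (fun q => q - x) '' {q | q ∈ Q ∧ q ∉ L}) ↔
      ∃ g ∈ L, ∃ m l : ℤ, 0 ≤ m ∧ 0 ≤ l ∧ w = g + m • x + l • (v - x) := by
  constructor
  · intro hw
    induction hw using AddSubmonoid.closure_induction with
    | mem z hz =>
      rcases hz with hz | ⟨q, ⟨hq, hqL⟩, rfl⟩
      · obtain ⟨g, hg, m, l, hm, hml, rfl⟩ := (hQ z).1 hz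
        -- `m v + l x = (m + l) x + m (v − x)`
        obtain ⟨f1, f2, f3⟩ := mul_le_facts c l
        have f5 := f3 1 (by omega)
        exact ⟨g, hg, m + l, m, by omega, hm, by module⟩
      · obtain ⟨g, hg, m, l, hm, hml, rfl⟩ := (hQ q).1 hq
        rw [mem_L_iff hind hg] at hqL
        obtain ⟨f1, f2, f3⟩ := mul_le_facts c l
        have f4 := f3 2 hc
        have f5 := f3 1 (by omega)
        exact ⟨g, hg, m + l - 1, m, by omega, hm, by module⟩
    | zero => exact ⟨0, L.zero_mem, 0, 0, le_rfl, le_rfl, by simp⟩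
    | add y z _ _ hy hz =>
      obtain ⟨g₁, hg₁, m₁, l₁, hm₁, hl₁, rfl⟩ := hy
      obtain ⟨g₂, hg₂, m₂, l₂, hm₂, hl₂, rfl⟩ := hz
      exact ⟨g₁ + g₂, L.add_mem hg₁ hg₂, m₁ + m₂, l₁ + l₂, by omega, by omega, by module⟩
  · rintro ⟨g, hg, m, l, hm, hl, rfl⟩
    obtain ⟨⟨hvQ, hvL⟩, ⟨hxQ, hxL⟩, -⟩ := vertex_gens_mem hQ hind
    have hgQ : g ∈ Q := (hQ g).2 ⟨g, hg, 0, 0, le_rfl, by simp, by simp⟩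
    set M := AddSubmonoid.closure ((Q : Set (Fin n → ℤ)) ∪ (fun q => q - x) '' {q | q ∈ Q ∧ q ∉ L})
    have hQ' : ∀ q ∈ Q, q ∈ M := fun q hq => AddSubmonoid.subset_closure (Or.inl hq)
    have hgen : ∀ q ∈ Q, q ∉ L → q - x ∈ M :=
      fun q hq hqL => AddSubmonoid.subset_closure (Or.inr ⟨q, ⟨hq, hqL⟩, rfl⟩)
    have e : g + m • x + l • (v - x) = g + m.toNat • x + l.toNat • (v - x) := by
      rw [← natCast_zsmul x, ← natCast_zsmul (v - x), Int.toNat_of_nonneg hm, Int.toNat_of_nonneg hl]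
    rw [e]
    exact M.add_mem (M.add_mem (hQ' g hgQ) (M.nsmul_mem (hQ' x hxQ) _)) (M.nsmul_mem (hgen v hvQ hvL) _)

/-- The data `(v, y)`, `y = c v − x`, describe the same `Q` with the same parameter (the symmetry
`x ↔ y` of the vertex chart), so `mem_endBlowup_iff` also yields the chart at `y`. [folklore] -/
theorem vertex_symm
    (hQ : ∀ w, w ∈ Q ↔ ∃ g ∈ L, ∃ m l : ℤ, 0 ≤ m ∧ 0 ≤ m + (c : ℤ) * l ∧ w = g + m • v + l • x)
    (hind : ∀ g ∈ L, ∀ m l : ℤ, g + m • v + l • x = 0 → m = 0 ∧ l = 0) :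
    (∀ w, w ∈ Q ↔ ∃ g ∈ L, ∃ m l : ℤ, 0 ≤ m ∧ 0 ≤ m + (c : ℤ) * l ∧
        w = g + m • v + l • ((c : ℤ) • v - x)) ∧
      (∀ g ∈ L, ∀ m l : ℤ, g + m • v + l • ((c : ℤ) • v - x) = 0 → m = 0 ∧ l = 0) := by
  constructor
  · intro w
    rw [hQ w]
    constructor
    · rintro ⟨g, hg, m, l, hm, hml, rfl⟩
      refine ⟨g, hg, m + (c : ℤ) * l, -l, by omega, ?_, by module⟩
      rw [mul_neg]; omega
    · rintro ⟨g, hg, m, l, hm, hml, rfl⟩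
      refine ⟨g, hg, m + (c : ℤ) * l, -l, by omega, ?_, by module⟩
      rw [mul_neg]; omega
  · intro g hg m l h
    have h1 : g + (m + (c : ℤ) * l) • v + (-l) • x = 0 := by
      rw [← h]; module
    have := hind g hg _ _ h1
    constructor
    · have hl : l = 0 := by omega
      rw [hl, mul_zero, add_zero] at this
      exact this.1
    · omega

end Summit.ResolutionOfSingularities.ResolutionOfSingularities.Theorems.FRationalResolution.VertexChartMonoid
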